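import Mathlib
import Literature.AlgebraicGeometry.Resolution.TranscendenceDefect
import Literature.AlgebraicGeometry.Resolution.AbhyankarInvariants
import Literature.AlgebraicGeometry.Resolution.AbhyankarBases
import Literature.AlgebraicGeometry.Resolution.InseparableLocalUniformizationHeightStepTwo
import Summits.ResolutionOfSingularities.ResolutionOfSingularities.Theorems.AbhyankarShadowsSemivaluationShadowsRuledOverAbhyankarBaseShadowsHelpers
import Summits.ResolutionOfSingularities.ResolutionOfSingularities.Theorems.AbhyankarShadowsSemivaluationShadowsRuledOverAbhyankarBaseShadowsTransfer
import Summits.ResolutionOfSingularities.ResolutionOfSingularities.Theorems.AbhyankarShadowsSemivaluationShadowsFrameChart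
import Summits.ResolutionOfSingularities.ResolutionOfSingularities.Theorems.AbhyankarShadowsSemivaluationShadowsBaseSaturation
import Summits.ResolutionOfSingularities.ResolutionOfSingularities.Theorems.AbhyankarShadowsSemivaluationShadowsMinimalSpecialisation
import Summits.ResolutionOfSingularities.ResolutionOfSingularities.Theorems.AbhyankarShadowsSemivaluationShadowsEvalRationalFunctions
import Summits.ResolutionOfSingularities.ResolutionOfSingularities.Theorems.ShadowsUniformize.Negative.IdentityShadow
import HarnessLib

/-!
# Shadows for `K` ruled over an Abhyankar base (`stub_ruledOverAbhyankarBaseShadows`)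

Crux `SemivaluationShadows` (item `stmt-ResolutionOfSingularities-16757`, route
`ResolutionOfSingularities/AbhyankarShadows`, the EXISTENCE half of Teissier's semivaluation
conjecture typed over finite sets), line `birth`, registered stub
`stub_ruledOverAbhyankarBaseShadows`, PROVED: `ruledOverAbhyankarBaseShadows_of` (the engine,
saturation taken in any algebraically closed algebraic extension `M ⊇ K`),
`ruledOverAbhyankarBaseShadows` (binder form, `M = K̄`, conclusion `HasShadow O R F` unfolded) and
`stub_ruledOverAbhyankarBaseShadows : Sig.stub_ruledOverAbhyankarBaseShadows` (the registered
signature by name; `HasShadow` and `Sig.stub_ruledOverAbhyankarBaseShadows` are copied VERBATIM,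
`private`, from the line skeleton `Cruxes/SemivaluationShadows/Lines/birth.lean` (v6), which a
Theorems file cannot import).

**Statement.** `k` algebraically closed of characteristic `p`, `K/k` finitely generated, `O ∋ k`
a RATIONAL valuation ring of `K` with ARCHIMEDEAN value group of rational rank `r`, and a ruled
presentation `K = K₀(y)`: `y` transcendental over an intermediate field `K₀`, finitely generated
over `k`, on which `ν` is ABHYANKAR (`transcendenceDefect k (O ∩ K₀) = 0`) and which carries the
rational rank (every value of `K^×` has a positive power among the values of `K₀^×`). Then every
finitely generated `R ⊆ O` and finite `F ⊆ R` admit a SHADOW exact on `F`.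

**Proof (the minimal-approximant engine over an Abhyankar base).** (1) `baseSaturation_of`
(`B = K₀`): `V` on `M`, `V ∩ K = O`, values torsion over those of `K₀`, residues constants.
(2) Generators `gⱼ` of a model `R₀ ⊇ R` (`exists_fg_isFractionRing_le`) and the elements of `F`
written `Pⱼ(y)/Qⱼ(y)` over `K₀`; residue constants `cⱼ`. (3) A minimal approximant `ρ' ∈ M`
(`exists_minimal_exact_specialisation_of_algebra`), EXACT on `{Pⱼ, Qⱼ, Pⱼ - cⱼ Qⱼ}` and on every
non-zero polynomial of degree `< [K₀(ρ') : K₀]`: every non-zero `q(ρ') ∈ L = K₀(ρ')` has the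
value of `q(y) ∈ K` (EXACT REALISATION). (4) `evalRationalFunctions`: `φ = ev_{y := ρ'}` on
`K₀[y, gⱼ]`. (5) `O_L = V ∩ L` is rational, ARCHIMEDEAN (`RuledAbh.archimedean_transport`),
`L/k` finitely generated and ABHYANKAR (`transcendenceDefect_eq_zero_of_finite` over `O ∩ K₀`) of
rational rank `r` (`RuledAbh.ratRank_comap_eq_of_torsion`), so its value lattice has a frame `T`
(`RuledAbh.latticeFrame`). (6) `frameChart` DOWNSTAIRS on `L` with `T` and `A = k[φ(gⱼ)]`: a
Perron transform `T'` and a model `R_L ⊇ A ∪ T'` of `L` on which `V` is monomial in `T'`.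
(7) EXACT LIFTS `eⱼ = qⱼ(y) ∈ K` of `T'ⱼ = qⱼ(ρ')` (step 3) and the transfer
`RuledAbh.shadow_of_exact_evaluation` (model `R₁ = k[gⱼ, eⱼ]`, `φ|R₁ → L`, `frameShadow`).
Classically: minimal pairs (Alexandru–Popescu–Zaharescu) and Knaf–Kuhlmann's uniformization of
Abhyankar places; no named fact beyond the tree's is used. [folklore]
-/

-- single-problem summit: the doubled namespace component `ResolutionOfSingularities` is forced
set_option linter.dupNamespace false

noncomputable section

open Polynomial Literature.AlgebraicGeometry.Resolution

namespace Summit.ResolutionOfSingularities.ResolutionOfSingularities.Theorems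

/-! ## The engine, over an arbitrary algebraically closed algebraic extension `M ⊇ K` -/

set_option maxHeartbeats 400000 in
/-- **Shadows for `K` ruled over an Abhyankar base** (general form of
`ruledOverAbhyankarBaseShadows`, the saturation being taken in any algebraically closed algebraic
extension `M` of `K`; module docstring). [folklore] -/
theorem ruledOverAbhyankarBaseShadows_of (p : ℕ) (hp : p.Prime) (k K : Type) [Field k]
    [CharP k p] [IsAlgClosed k] [Field K] [Algebra k K] (hfg : (⊤ : IntermediateField k K).FG)
    (O : ValuationSubring K) (hk : ∀ c : k, algebraMap k K c ∈ O)
    (hrat : ∀ x : K, x ∈ O → ∃ c : k, O.valuation (x - algebraMap k K c) < 1)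
    (hr1 : ∀ z w : K, O.valuation z < 1 → w ≠ 0 → ∃ N : ℕ, O.valuation z ^ N < O.valuation w)
    (r : ℕ) (hrr : Module.finrank ℤ (Additive (O.ValueGroup)ˣ) = r)
    (K₀ : IntermediateField k K) (y : K)
    (hk₀ : ∀ c : k, algebraMap k K₀ c ∈ O.comap (algebraMap K₀ K)) (hK₀ : K₀.FG)
    (hD₀ : transcendenceDefect k (O.comap (algebraMap K₀ K)) hk₀ = 0)
    (htors : ∀ z : K, z ≠ 0 → ∃ N : ℕ, N ≠ 0 ∧ ∃ b : K, b ∈ K₀ ∧ b ≠ 0 ∧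
      O.valuation z ^ N = O.valuation b)
    (hy : Transcendental K₀ y) (hgen : IntermediateField.adjoin K₀ {y} = ⊤)
    (R : Subalgebra k K) (hR : R.FG) (hRO : R.toSubring ≤ O.toSubring) (F : Finset R)
    (M : Type) [Field M] [IsAlgClosed M] [Algebra K M] [Algebra k M] [IsScalarTower k K M]
    [Algebra.IsAlgebraic K M] :
    ∃ (R₁ : Subalgebra k K) (hle : R ≤ R₁) (_ : R₁.toSubring ≤ O.toSubring), R₁.FG ∧
    IsFractionRing R₁ K ∧ ∃ (L : Type) (_ : Field L) (_ : Algebra k L) (φ : R₁ →ₐ[k] L)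
    (O' : ValuationSubring L), Module.finrank ℤ (Additive (O'.ValueGroup)ˣ) =
      Module.finrank ℤ (Additive (O.ValueGroup)ˣ) ∧ (∀ y : R₁, φ y ∈ O') ∧
    (∀ y : R₁, O'.valuation (φ y) < 1 ↔ O.valuation (y : K) < 1) ∧
    (∀ z : L, z ∈ O' → ∃ c : k, O'.valuation (z - algebraMap k L c) < 1) ∧
    (MonoidHom.mrange (O'.valuation.toMonoidWithZeroHom.toMonoidHom.comp
      φ.toRingHom.toMonoidHom)).FG ∧
    ∃ ι : O'.ValueGroup →*₀o O.ValueGroup, Function.Injective ι ∧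
      (∀ y : R₁, φ y ≠ 0 → ∃ y' : R₁, ι (O'.valuation (φ y)) = O.valuation (y' : K)) ∧
      ∀ x ∈ F, ι (O'.valuation (φ (Subalgebra.inclusion hle x))) = O.valuation ((x : R) : K) := by
  classical
  -- Step 1: saturation of `ν` in `M` over the torsion base `K₀`
  obtain ⟨V, hVO, htorsV, hres, hd, -, -⟩ :=
    baseSaturation_of (M := M) O hk hrat (K₀ : Set K) (fun z hz => by
      obtain ⟨N, hN, b, hb, hb0, h⟩ := htors z hz
      exact ⟨N, hN, b, hb, hb0, h⟩)
  have hres' : ∀ u : M, V.valuation u = 1 → ∃ c : k, V.valuation (u - algebraMap k M c) < 1 :=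
    fun u hu => by simpa only [← IsScalarTower.algebraMap_apply] using hres u hu
  have hkV : ∀ c : k, algebraMap k M c ∈ V := fun c => by
    simpa only [← hVO, ValuationSubring.mem_comap, ← IsScalarTower.algebraMap_apply] using hk c
  -- Step 2: `K = K₀(y)`: every element is a fraction of polynomials in `y`
  have hinj : Function.Injective (aeval y : K₀[X] →ₐ[K₀] K) := transcendental_iff_injective.mp hy
  have haev0 : ∀ f : K₀[X], f ≠ 0 → aeval y f ≠ 0 := fun f hf => (map_ne_zero_iff _ hinj).mpr hf
  have hrep : ∀ z : K, ∃ P Q : K₀[X], Q ≠ 0 ∧ z * aeval y Q = aeval y P := by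
    intro z
    have hz : z ∈ IntermediateField.adjoin K₀ {y} := by rw [hgen]; trivial
    obtain ⟨f, g, hfg'⟩ := (IntermediateField.mem_adjoin_simple_iff K₀ z).mp hz
    by_cases hg : aeval y g = 0
    · refine ⟨0, 1, one_ne_zero, ?_⟩
      rw [hfg', hg, div_zero, zero_mul, map_zero]
    · refine ⟨f, g, fun h => hg (by rw [h, map_zero]), ?_⟩
      rw [hfg', div_mul_cancel₀ _ hg]
  choose P Q hQ0 hPQ using hrep
  have hPQ' : ∀ z : K, aeval y (P z) / aeval y (Q z) = z := fun z =>
    (eq_div_of_mul_eq (haev0 _ (hQ0 z)) (hPQ z)).symm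
  -- residue constants
  have hc' : ∀ x : K, ∃ c : k, x ∈ O → O.valuation (x - algebraMap k K c) < 1 := fun x => by
    by_cases hx : x ∈ O
    · obtain ⟨c, hc⟩ := hrat x hx
      exact ⟨c, fun _ => hc⟩
    · exact ⟨0, fun h => absurd h hx⟩
  choose c hc using hc'
  -- Step 3: a first model `R₀ = k[s]` and the finite set of polynomials to be kept exact
  obtain ⟨R₀, hRR₀, hR₀O, ⟨s, hs⟩, hfrac₀⟩ :=
    ShadowsUniformize.Negative.exists_fg_isFractionRing_le hfg O hk R hR hRO
  let s₂ : Finset K := s ∪ F.image fun x => ((x : R) : K)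
  have hs₂O : ∀ g ∈ s₂, g ∈ O := by
    intro g hg
    rcases Finset.mem_union.mp hg with hg | hg
    · exact hR₀O (show g ∈ R₀ from hs ▸ Algebra.subset_adjoin hg)
    · obtain ⟨x, -, rfl⟩ := Finset.mem_image.mp hg
      exact hRO (x : R).2
  let S₀ : Finset K₀[X] := s₂.biUnion fun g => {P g, Q g, P g - C (algebraMap k K₀ (c g)) * Q g}
  have hPmem : ∀ g ∈ s₂, P g ∈ S₀ := fun g hg => Finset.mem_biUnion.mpr ⟨g, hg, by simp⟩
  have hQmem : ∀ g ∈ s₂, Q g ∈ S₀ := fun g hg => Finset.mem_biUnion.mpr ⟨g, hg, by simp⟩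
  have hPQmem : ∀ g ∈ s₂, P g - C (algebraMap k K₀ (c g)) * Q g ∈ S₀ := fun g hg =>
    Finset.mem_biUnion.mpr ⟨g, hg, by simp⟩
  -- Step 4: the minimal approximant `ρ'`
  have htors' : ∀ z : M, z ≠ 0 → ∃ N : ℕ, N ≠ 0 ∧ ∃ b : K₀,
      V.valuation z ^ N = V.valuation (algebraMap K₀ M b) := by
    intro z hz
    obtain ⟨N, hN, b, hb, -, h⟩ := htorsV z hz
    exact ⟨N, hN, ⟨b, hb⟩, by rw [IsScalarTower.algebraMap_apply K₀ K M]; exact h⟩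
  have hresK₀ : ∀ u : M, V.valuation u = 1 → ∃ b : K₀, V.valuation (u - algebraMap K₀ M b) < 1 := by
    intro u hu
    obtain ⟨a, ha⟩ := hres' u hu
    exact ⟨algebraMap k K₀ a, by rwa [← IsScalarTower.algebraMap_apply]⟩
  have hyM : Transcendental K₀ (algebraMap K M y) :=
    (transcendental_algebraMap_iff (algebraMap K M).injective).mpr hy
  obtain ⟨ρ', hρ'alg, hexS, hexdeg⟩ := exists_minimal_exact_specialisation_of_algebra (F₀ := K₀)
    (M := M) V.valuation htors' hresK₀ hyM (S₀.filter (· ≠ 0))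
    (fun f hf => (Finset.mem_filter.mp hf).2)
  have hex : ∀ f ∈ S₀, V.valuation (aeval ρ' f) = V.valuation (algebraMap K M (aeval y f)) := by
    intro f hf
    by_cases hf0 : f = 0
    · simp only [hf0, map_zero]
    · rw [hexS f (Finset.mem_filter.mpr ⟨hf, hf0⟩), aeval_algebraMap_apply]
  have hexne : ∀ f ∈ S₀, f ≠ 0 → aeval ρ' f ≠ 0 := fun f hf hf0 h => haev0 f hf0 <|
    (map_eq_zero _).mp <| (map_eq_zero V.valuation).mp <|
      (hex f hf).symm.trans (by rw [h, map_zero])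
  have hexlow : ∀ g : K₀[X], g ≠ 0 → g.natDegree < (minpoly K₀ ρ').natDegree →
      V.valuation (aeval ρ' g) = V.valuation (algebraMap K M (aeval y g)) := fun g hg hdeg => by
    rw [hexdeg g hg hdeg, aeval_algebraMap_apply]
  -- Step 5: the evaluation map `φ = ev_{y := ρ'}` on `D = K₀[y, g (g ∈ s₂)]`
  let P' : Fin s₂.card → K₀[X] := fun i => P ((s₂.equivFin.symm i : s₂) : K)
  let Q' : Fin s₂.card → K₀[X] := fun i => Q ((s₂.equivFin.symm i : s₂) : K)
  let D : Subalgebra K₀ K :=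
    Algebra.adjoin K₀ (insert y (Set.range fun i => aeval y (P' i) / aeval y (Q' i)))
  obtain ⟨φ, -, hφ⟩ : ∃ φ : D →ₐ[K₀] M, φ ⟨y, Algebra.subset_adjoin (Set.mem_insert _ _)⟩ = ρ' ∧
      ∀ (z : D) (A B : K₀[X]), aeval ρ' B ≠ 0 → (z : K) * aeval y B = aeval y A →
        φ z = aeval ρ' A / aeval ρ' B :=
    evalRationalFunctions K₀ K M y hy ρ' _ P' Q' fun i =>
      hexne _ (hQmem _ (s₂.equivFin.symm i).2) (hQ0 _)
  have hyD : y ∈ D := Algebra.subset_adjoin (Set.mem_insert _ _)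
  have hpolyD : ∀ f : K₀[X], aeval y f ∈ D := fun f =>
    Algebra.adjoin_le (Set.singleton_subset_iff.mpr hyD) (aeval_mem_adjoin_singleton K₀ y)
  have hs₂D : ∀ g ∈ s₂, g ∈ D := fun g hg =>
    Algebra.subset_adjoin (Set.mem_insert_of_mem _ ⟨s₂.equivFin ⟨g, hg⟩, by simp [P', Q', hPQ']⟩)
  -- exactness of `φ` at the elements of `s₂`, against any admissible constant
  have hexact : ∀ (g : K) (hg : g ∈ s₂) (a : k), P g - C (algebraMap k K₀ a) * Q g ∈ S₀ →
      V.valuation (φ ⟨g, hs₂D g hg⟩ - algebraMap k M a) =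
        V.valuation (algebraMap K M (g - algebraMap k K a)) := by
    intro g hg a hmem
    have hQρ : aeval ρ' (Q g) ≠ 0 := hexne _ (hQmem g hg) (hQ0 g)
    have h1 : φ ⟨g, hs₂D g hg⟩ - algebraMap k M a =
        aeval ρ' (P g - C (algebraMap k K₀ a) * Q g) / aeval ρ' (Q g) := by
      rw [hφ ⟨g, hs₂D g hg⟩ (P g) (Q g) hQρ (hPQ g), map_sub, map_mul, aeval_C,
        ← IsScalarTower.algebraMap_apply, sub_div, mul_div_cancel_right₀ _ hQρ]
    have h2 : g - algebraMap k K a =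
        aeval y (P g - C (algebraMap k K₀ a) * Q g) / aeval y (Q g) := by
      rw [map_sub, map_mul, aeval_C, ← IsScalarTower.algebraMap_apply, sub_div,
        mul_div_cancel_right₀ _ (haev0 _ (hQ0 g)), hPQ']
    rw [h1, h2, map_div₀, map_div₀, map_div₀, hex _ hmem, hex _ (hQmem g hg)]
  have hexact0 : ∀ (g : K) (hg : g ∈ s₂),
      V.valuation (φ ⟨g, hs₂D g hg⟩) = V.valuation (algebraMap K M g) := fun g hg => by
    have h := hexact g hg 0 (by simpa using hPmem g hg)
    rwa [map_zero, map_zero, sub_zero, sub_zero] at h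
  -- Step 6: `L = K₀(ρ')`, its valuation ring `O_L = V ∩ L`
  have hint : IsIntegral K₀ ρ' := hρ'alg.isIntegral
  set Lf : IntermediateField K₀ M := IntermediateField.adjoin K₀ {ρ'} with hLfdef
  haveI : FiniteDimensional K₀ Lf := IntermediateField.adjoin.finiteDimensional hint
  haveI : IsScalarTower k Lf M := IsScalarTower.of_algebraMap_eq fun _ => rfl
  have hpolyL : ∀ f : K₀[X], aeval ρ' f ∈ Lf := fun f =>
    IntermediateField.algebra_adjoin_le_adjoin K₀ _ (aeval_mem_adjoin_singleton K₀ ρ')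
  set OL : ValuationSubring Lf := V.comap (algebraMap Lf M) with hOLdef
  have hOL : V.comap (algebraMap Lf M) = OL := rfl
  have hkL : ∀ a : k, algebraMap Lf M (algebraMap k Lf a) = algebraMap k M a := fun a =>
    (IsScalarTower.algebraMap_apply k Lf M a).symm
  have hkOL : ∀ a : k, algebraMap k Lf a ∈ OL := fun a => by
    rw [ValuationSubring.mem_comap, hkL]
    exact hkV a
  -- exact realisation of the non-zero elements of `L` by polynomials in `y`
  have hreal : ∀ z : Lf, z ≠ 0 → ∃ q : K₀[X], algebraMap Lf M z = aeval ρ' q ∧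
      V.valuation (aeval ρ' q) = V.valuation (algebraMap K M (aeval y q)) := by
    intro z hz
    obtain ⟨q, hqdeg, hq⟩ := (IntermediateField.adjoin.powerBasis hint).exists_eq_aeval z
    rw [IntermediateField.adjoin.powerBasis_dim] at hqdeg
    have hzM : algebraMap Lf M z = aeval ρ' q := by
      rw [hq, IntermediateField.adjoin.powerBasis_gen, ← aeval_algebraMap_apply,
        IntermediateField.AdjoinSimple.algebraMap_gen]
    have hq0 : q ≠ 0 := by
      rintro rfl
      exact hz (by rw [hq, map_zero])
    exact ⟨q, hzM, hexlow q hq0 hqdeg⟩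
  -- `L/k` finitely generated, `O_L` Abhyankar, rational, archimedean, of rational rank `r`
  have hfgK₀ : (⊤ : IntermediateField k K₀).FG := intermediateField_fg_top_of_fg K₀ hK₀
  have hfgL : (⊤ : IntermediateField k Lf).FG := intermediateField_fg_top_of_finite (K := K₀) hfgK₀
  have hcomap : OL.comap (algebraMap K₀ Lf) = O.comap (algebraMap K₀ K) :=
    RuledAbh.comap_comap_eq_comap V O hVO
  have hDL' : transcendenceDefect k (OL.comap (algebraMap K₀ Lf))
      (algebraMap_mem_comap_of_mem OL hkOL) = 0 := by
    rw [RuledAbh.transcendenceDefect_congr hcomap (algebraMap_mem_comap_of_mem OL hkOL) hk₀]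
    exact hD₀
  obtain ⟨hDL, hEL, -, -⟩ := transcendenceDefect_eq_zero_of_finite OL hkOL hfgK₀ hDL'
  have hratL : ∀ z : Lf, z ∈ OL → ∃ a : k, OL.valuation (z - algebraMap k Lf a) < 1 := by
    intro z hz
    have hz1 : V.valuation (algebraMap Lf M z) ≤ 1 :=
      (V.valuation_le_one_iff _).mpr (ValuationSubring.mem_comap.mp hz)
    rcases hz1.lt_or_eq with hlt | h1
    · exact ⟨0, by rwa [map_zero, sub_zero, ← valuation_map_lt_one_iff (algebraMap Lf M) hOL]⟩
    · obtain ⟨a, ha⟩ := hres' _ h1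
      exact ⟨a, by rwa [← valuation_map_lt_one_iff (algebraMap Lf M) hOL, map_sub, hkL]⟩
  have hr1L : ∀ z w : Lf, OL.valuation z < 1 → w ≠ 0 →
      ∃ N : ℕ, OL.valuation z ^ N < OL.valuation w :=
    RuledAbh.archimedean_transport (algebraMap K M) (algebraMap Lf M) V O OL hVO hOL
      (fun z hz => by
        obtain ⟨q, hzM, hqv⟩ := hreal z hz
        exact ⟨aeval y q, by rw [hzM]; exact hqv⟩) hr1
  have hsr : Module.finrank ℤ (Additive (OL.ValueGroup)ˣ) = r := by
    obtain ⟨-, -, hfr⟩ := valueGroup_lattice_of_transcendenceDefect_eq_zero OL hfgL hkOL hDL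
    have h3 := RuledAbh.ratRank_comap_eq_of_torsion hfg O hk r hrr K₀ htors
    rw [hEL, hcomap, h3] at hfr
    exact_mod_cast hfr
  -- the frame of the value lattice of `L`
  obtain ⟨T, hT0, hT1, hTgen, hTind⟩ := RuledAbh.latticeFrame hfgL OL hkOL hDL r hsr
  -- Step 7: the prescribed-frame chart DOWNSTAIRS, absorbing `A = k[φ(g) : g ∈ s]`
  let vL : K → Lf := fun g => ⟨aeval ρ' (P g) / aeval ρ' (Q g), div_mem (hpolyL _) (hpolyL _)⟩
  have hvLφ : ∀ (g : K) (hg : g ∈ s₂), φ ⟨g, hs₂D g hg⟩ = algebraMap Lf M (vL g) := fun g hg =>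
    hφ _ (P g) (Q g) (hexne _ (hQmem g hg) (hQ0 g)) (hPQ g)
  have hvLO : ∀ g ∈ s₂, vL g ∈ OL := fun g hg => by
    rw [ValuationSubring.mem_comap, ← V.valuation_le_one_iff, ← hvLφ g hg, hexact0 g hg,
      V.valuation_le_one_iff, ← ValuationSubring.mem_comap, hVO]
    exact hs₂O g hg
  let OLa : Subalgebra k Lf :=
    { OL.toSubring with
      algebraMap_mem' := hkOL }
  let A : Subalgebra k Lf := Algebra.adjoin k ((s.image vL : Finset Lf) : Set Lf)
  have hAfg : A.FG := ⟨s.image vL, rfl⟩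
  have hAO : A.toSubring ≤ OL.toSubring := by
    have h : A ≤ OLa := Algebra.adjoin_le fun v hv => by
      obtain ⟨g, hg, rfl⟩ := Finset.mem_image.mp (Finset.mem_coe.mp hv)
      exact hvLO g (Finset.mem_union_left _ hg)
    exact fun x hx => h hx
  obtain ⟨T', C', D', hCD, -, hT'j, hT'lt, RL, -, hT'R, hARL, -, hfracL, -, hmono⟩ :=
    frameChart p hp k Lf hfgL OL hkOL hratL hDL hr1L r T hT0 hT1 hTgen hTind A hAfg hAO
  have hT'0 : ∀ j, T' j ≠ 0 := fun j =>
    (hT'j j).symm ▸ Finset.prod_ne_zero_iff.mpr fun i _ => zpow_ne_zero _ (hT0 i)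
  have hT'ind : ∀ m : Fin r → ℤ, (∏ j, OL.valuation (T' j) ^ (m j)) = 1 → m = 0 :=
    PfaffLine.perron_valIndep_of_matrix OL T hT0 hTind C' D' hCD T' hT'j
  -- Step 8: exact lifts of the transformed frame, and the transfer
  choose q hTq hqex using fun j => hreal (T' j) (hT'0 j)
  refine RuledAbh.shadow_of_exact_evaluation k K M Lf D O hk hrat r hrr V hVO hres'
    (algebraMap Lf M) hkL OL hOL (D.val.restrictScalars k) (fun a b h => Subtype.ext h)
    (φ.restrictScalars k) R s (hs ▸ hRR₀) (hs ▸ hfrac₀) RL hfracL T' hT'0 hT'R hT'lt hT'ind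
    hmono ?_ (fun j => aeval y (q j)) ?_ ?_ F ?_
  · -- generators: in `D`, evaluated into `A ⊆ R_L`, bi-congruent to `c g`
    intro x hx
    have hx₂ : x ∈ s₂ := Finset.mem_union_left _ hx
    have hxO : x ∈ O := hs₂O x hx₂
    refine ⟨⟨x, hs₂D x hx₂⟩, rfl, ⟨vL x, hARL (Algebra.subset_adjoin
      (Finset.mem_coe.mpr (Finset.mem_image_of_mem vL hx))), (hvLφ x hx₂).symm⟩, c x, hc x hxO, ?_⟩
    show V.valuation (φ ⟨x, _⟩ - _) < 1
    rw [hexact x hx₂ (c x) (hPQmem x hx₂), ← hd]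
    exact hc x hxO
  · -- lifts: `φ (qⱼ(y)) = qⱼ(ρ') = T'ⱼ`
    intro j
    refine ⟨⟨aeval y (q j), hpolyD _⟩, rfl, ?_⟩
    show φ ⟨aeval y (q j), _⟩ = algebraMap Lf M (T' j)
    rw [hTq j, hφ ⟨_, hpolyD _⟩ (q j) 1 (by rw [map_one]; exact one_ne_zero)
      (by rw [map_one, mul_one]), map_one, div_one]
  · -- lifts are exact (minimality of `ρ'`)
    intro j
    rw [hTq j]
    exact hqex j
  · -- exactness on `F`
    intro x hxF
    have hx₂ : ((x : R) : K) ∈ s₂ :=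
      Finset.mem_union_right _ (Finset.mem_image.mpr ⟨x, hxF, rfl⟩)
    exact ⟨⟨_, hs₂D _ hx₂⟩, rfl, hexact0 _ hx₂⟩

/-- **Shadows for `K` ruled over an Abhyankar base, archimedean value group** (binder form of
the registered stub `stub_ruledOverAbhyankarBaseShadows`; conclusion = the crux's
`HasShadow O R F` unfolded verbatim; module docstring). The standing hypothesis
`transcendenceDefect k O hk ≠ 0` of the skeleton's branch is not needed. [folklore] -/
theorem ruledOverAbhyankarBaseShadows (p : ℕ) (hp : p.Prime) (k K : Type) [Field k] [CharP k p]
    [IsAlgClosed k] [Field K] [Algebra k K] (hfg : (⊤ : IntermediateField k K).FG)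
    (O : ValuationSubring K) (hk : ∀ c : k, algebraMap k K c ∈ O)
    (hrat : ∀ x : K, x ∈ O → ∃ c : k, O.valuation (x - algebraMap k K c) < 1)
    (_hD : transcendenceDefect k O hk ≠ 0)
    (hr1 : ∀ z w : K, O.valuation z < 1 → w ≠ 0 → ∃ N : ℕ, O.valuation z ^ N < O.valuation w)
    (r : ℕ) (hrr : Module.finrank ℤ (Additive (O.ValueGroup)ˣ) = r)
    (K₀ : IntermediateField k K) (y : K)
    (hk₀ : ∀ c : k, algebraMap k K₀ c ∈ O.comap (algebraMap K₀ K)) (hK₀ : K₀.FG)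
    (hD₀ : transcendenceDefect k (O.comap (algebraMap K₀ K)) hk₀ = 0)
    (htors : ∀ z : K, z ≠ 0 → ∃ N : ℕ, N ≠ 0 ∧ ∃ b : K, b ∈ K₀ ∧ b ≠ 0 ∧
      O.valuation z ^ N = O.valuation b)
    (hy : Transcendental K₀ y) (hgen : IntermediateField.adjoin K₀ {y} = ⊤)
    (R : Subalgebra k K) (hR : R.FG) (hRO : R.toSubring ≤ O.toSubring) (F : Finset R) :
    ∃ (R₁ : Subalgebra k K) (hle : R ≤ R₁) (_ : R₁.toSubring ≤ O.toSubring), R₁.FG ∧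
    IsFractionRing R₁ K ∧ ∃ (L : Type) (_ : Field L) (_ : Algebra k L) (φ : R₁ →ₐ[k] L)
    (O' : ValuationSubring L), Module.finrank ℤ (Additive (O'.ValueGroup)ˣ) =
      Module.finrank ℤ (Additive (O.ValueGroup)ˣ) ∧ (∀ y : R₁, φ y ∈ O') ∧
    (∀ y : R₁, O'.valuation (φ y) < 1 ↔ O.valuation (y : K) < 1) ∧
    (∀ z : L, z ∈ O' → ∃ c : k, O'.valuation (z - algebraMap k L c) < 1) ∧
    (MonoidHom.mrange (O'.valuation.toMonoidWithZeroHom.toMonoidHom.comp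
      φ.toRingHom.toMonoidHom)).FG ∧
    ∃ ι : O'.ValueGroup →*₀o O.ValueGroup, Function.Injective ι ∧
      (∀ y : R₁, φ y ≠ 0 → ∃ y' : R₁, ι (O'.valuation (φ y)) = O.valuation (y' : K)) ∧
      ∀ x ∈ F, ι (O'.valuation (φ (Subalgebra.inclusion hle x))) = O.valuation ((x : R) : K) :=
  ruledOverAbhyankarBaseShadows_of p hp k K hfg O hk hrat hr1 r hrr K₀ y hk₀ hK₀ hD₀ htors hy hgen
    R hR hRO F (AlgebraicClosure K)

/-! ## The registered stub signature, by name (`private` VERBATIM copies of the skeleton's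
`HasShadow` and `Sig.stub_ruledOverAbhyankarBaseShadows`, unfolding definitionally to them) -/

/-- VERBATIM copy of the skeleton's `HasShadow O R F` (a predicate of the line skeleton, not a
named fact): the conclusion of the crux `SemivaluationShadows` for one datum — a finite set
`F` of a finitely generated `k`-subalgebra `R` of `K` inside the valuation ring `O` — copied VERBATIM
from the route file (`∃ R₁ hle _, R₁.FG ∧ IsFractionRing R₁ K ∧ ∃ L _ _ φ O', …`). -/
private def HasShadow {k K : Type} [Field k] [Field K] [Algebra k K] (O : ValuationSubring K)
    (R : Subalgebra k K) (F : Finset R) : Prop :=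
  ∃ (R₁ : Subalgebra k K) (hle : R ≤ R₁) (_ : R₁.toSubring ≤ O.toSubring), R₁.FG ∧
    IsFractionRing R₁ K ∧ ∃ (L : Type) (_ : Field L) (_ : Algebra k L) (φ : R₁ →ₐ[k] L)
    (O' : ValuationSubring L), Module.finrank ℤ (Additive (O'.ValueGroup)ˣ) =
      Module.finrank ℤ (Additive (O.ValueGroup)ˣ) ∧ (∀ y : R₁, φ y ∈ O') ∧
    (∀ y : R₁, O'.valuation (φ y) < 1 ↔ O.valuation (y : K) < 1) ∧
    (∀ z : L, z ∈ O' → ∃ c : k, O'.valuation (z - algebraMap k L c) < 1) ∧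
    (MonoidHom.mrange (O'.valuation.toMonoidWithZeroHom.toMonoidHom.comp
      φ.toRingHom.toMonoidHom)).FG ∧
    ∃ ι : O'.ValueGroup →*₀o O.ValueGroup, Function.Injective ι ∧
      (∀ y : R₁, φ y ≠ 0 → ∃ y' : R₁, ι (O'.valuation (φ y)) = O.valuation (y' : K)) ∧
      ∀ x ∈ F, ι (O'.valuation (φ (Subalgebra.inclusion hle x))) = O.valuation ((x : R) : K)

/-- VERBATIM copy of the skeleton's registered signature `Sig.stub_ruledOverAbhyankarBaseShadows`
(v6; the statement of the stub, PROVED below as `stub_ruledOverAbhyankarBaseShadows` — not a named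
fact): the RULED case over an ABHYANKAR skeleton, rank-one (archimedean) value group, any
rational rank: `K = K₀(y)` with `y` transcendental over an intermediate field `K₀`, finitely
generated over `k`, on which `ν` is Abhyankar (`transcendenceDefect = 0` for the restricted
valuation ring) and carries the rational rank (values of `K^×` torsion over values of `K₀^×`);
every finitely generated `R ⊆ O` and finite `F ⊆ R` admit a shadow. -/
private def Sig.stub_ruledOverAbhyankarBaseShadows : Prop :=
  ∀ p : ℕ, p.Prime → ∀ (k K : Type) [Field k] [CharP k p] [IsAlgClosed k] [Field K] [Algebra k K],
    (⊤ : IntermediateField k K).FG → ∀ (O : ValuationSubring K)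
    (hk : ∀ c : k, algebraMap k K c ∈ O),
    (∀ x : K, x ∈ O → ∃ c : k, O.valuation (x - algebraMap k K c) < 1) →
    transcendenceDefect k O hk ≠ 0 →
    (∀ z w : K, O.valuation z < 1 → w ≠ 0 → ∃ N : ℕ, O.valuation z ^ N < O.valuation w) →
    ∀ (r : ℕ), Module.finrank ℤ (Additive (O.ValueGroup)ˣ) = r →
    ∀ (K₀ : IntermediateField k K) (y : K)
    (hk₀ : ∀ c : k, algebraMap k K₀ c ∈ O.comap (algebraMap K₀ K)), K₀.FG →
    transcendenceDefect k (O.comap (algebraMap K₀ K)) hk₀ = 0 →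
    (∀ z : K, z ≠ 0 → ∃ N : ℕ, N ≠ 0 ∧ ∃ b : K, b ∈ K₀ ∧ b ≠ 0 ∧ O.valuation z ^ N = O.valuation b) →
    Transcendental K₀ y → IntermediateField.adjoin K₀ {y} = ⊤ →
    ∀ R : Subalgebra k K, R.FG → R.toSubring ≤ O.toSubring → ∀ F : Finset R, HasShadow O R F

/-- **STUB `stub_ruledOverAbhyankarBaseShadows` of line `birth` of crux `SemivaluationShadows`,
PROVED** (registered signature `Sig.stub_ruledOverAbhyankarBaseShadows`, by name; it unfolds to the
skeleton's statement verbatim): shadows for `K` ruled over an Abhyankar base with archimedean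
value group — `ruledOverAbhyankarBaseShadows`. [folklore] -/
theorem stub_ruledOverAbhyankarBaseShadows : Sig.stub_ruledOverAbhyankarBaseShadows :=
  fun p hp k K _ _ _ _ _ => ruledOverAbhyankarBaseShadows p hp k K

end Summit.ResolutionOfSingularities.ResolutionOfSingularities.Theorems

end
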